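import Summits.QuantumFields.YangMills.Theses.CoincidenceRotationBootstrap
import Summits.QuantumFields.YangMills.Theses.ScalingWindowSplit
import Summits.QuantumFields.YangMills.Theorems.ScalingWindowSplitCurvatureAmnesiaOfWardNullity
import Summits.QuantumFields.YangMills.Theorems.ScalingWindowSplitCurvatureAmnesiaStubWardNullityOne
import Summits.QuantumFields.YangMills.Theorems.ScalingWindowSplitCurvatureAmnesiaStubAngleCalculus
import Summits.QuantumFields.YangMills.Theorems.LangevinControlUVOSLegsFromFemtoAndGapStubUpgrade
import HarnessLib

/-!
# `CurvatureAmnesia ↔ lattice rotation-Ward nullity` — the equivalence certificate of line `WardDefectSketch`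
# (crux stmt-QuantumFields-16192)

Support file for the crux item stmt-QuantumFields-16192 (`CoincidenceRotationBootstrap.CurvatureAmnesia`, shared
verbatim with `ScalingWindowSplit.CurvatureAmnesia`).  The registered line `Cruxes/CurvatureAmnesia/Lines/WardDefectSketch.lean`
closes the crux modulo ONE registered stub, `stub_wardNullity_two_le` (W₂): under the crux's hypotheses verbatim, for every
`n ≥ 2` and every SEPARATED real family `f` (compact, pairwise disjoint supports) the angle-`0` one-insertion lattice Ward
functional `W_k(f) = Σᵢ ⟨Φ_k(f₁) ⋯ Φ_k(L fᵢ) ⋯ Φ_k(f_n)⟩_k` (`L = x₁∂₀ − x₀∂₁`) of the renormalised Wilson curvature correlators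
tends to `0`.  The direction (W₂) ⇒ crux is the landed funnel (`stub_cruxOfWardNullity`, with the landed (W₁)
`stub_wardNullity_one`).  This file proves the CONVERSE, so that the open residue of the line is certified to be the crux itself:

* `limit_of_derivs_eq_zero` (real analysis): if `φ_k' = −W_k` everywhere, every `W_k` is continuous, `φ_k → c` and `W_k → w`
  POINTWISE on `ℝ`, then `w = 0` — Baire's theorem gives an interval on which the `W_k` are uniformly bounded (Osgood), and there
  the fundamental theorem of calculus and dominated convergence give `(β − α) w = lim (φ_k α − φ_k β) = 0`;
* `wardNullity_of_planeInvariance` (the converse of `plane_apply_eq_of_wardNullity`): if the tied limit `S` of the curvature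
  correlators is invariant under every `(x₀,x₁)`-rotation on `⁰𝒮`, then `W_k(f) → 0` on every separated real family — the TIE makes
  the rotated correlator `θ ↦ ⟨∏Φ_k(fⱼ^θ)⟩_k` and the Ward functional `θ ↦ W_k(θ; f)` converge pointwise to CONSTANTS (invariance),
  the landed angle calculus gives `d/dθ ⟨∏Φ_k(fⱼ^θ)⟩_k = −W_k(θ; f)`, and the real-analysis lemma forces the constant to vanish;
* `rot_invariant_of_hyper_of_sigmaFive`: proper-hypercubic + Σ5 invariance of the curvature strings ⇒ invariance under every
  `(x₀,x₁)`-rotation (the landed density upgrade `Upgrade.upgrade`, `det_rho`);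
* `stub_wardNullity_two_le_of_curvatureAmnesia : CurvatureAmnesia → (W₂)` and the certificate
  `curvatureAmnesia_iff_wardNullity_two_le : CurvatureAmnesia ↔ (W₂)` (statement of (W₂) expanded verbatim as registered).

No definitions, no notation.  References: Osterwalder–Schrader 1973 §2 (E1); W. F. Osgood, *Non-uniform convergence and the
integration of series term by term*, Amer. J. Math. 19 (1897) (uniform boundedness on a subinterval, here via Baire); folklore.
-/

noncomputable section

namespace Summit.QuantumFields.YangMills.Cruxes.CurvatureAmnesia.WardDefect

open scoped BigOperators Topology SchwartzMap
open Filter MeasureTheory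
open Literature.MathematicalPhysics.QuantumLattice Literature.MathematicalPhysics.AQFT
  Literature.MathematicalPhysics.QuantumFieldTheory
open Summit.QuantumFields.YangMills.Theorems.OSLegsFromFemtoAndGap.Upgrade

/-! ## §1 Real analysis: pointwise limits of derivatives along a convergent sequence of primitives -/

/-- **Osgood–Baire step.**  Let `φ_k, W_k : ℝ → ℝ` with `φ_k' = −W_k` everywhere and every `W_k` continuous.  If `φ_k → c`
and `W_k → w` pointwise on `ℝ`, then `w = 0`: by Baire's theorem one of the closed sets `{s | ∀ k, |W_k s| ≤ N}` (which cover
`ℝ`, a convergent sequence being bounded) contains an interval `[α, β]`, `α < β`; there `∫_α^β W_k = φ_k α − φ_k β → 0`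
(fundamental theorem of calculus) and `∫_α^β W_k → (β − α) w` (dominated convergence). [folklore] -/
theorem limit_of_derivs_eq_zero {φ W : ℕ → ℝ → ℝ} {c w : ℝ}
    (hd : ∀ k s, HasDerivAt (φ k) (-(W k s)) s) (hWc : ∀ k, Continuous (W k))
    (hφ : ∀ s, Tendsto (fun k => φ k s) atTop (𝓝 c)) (hW : ∀ s, Tendsto (fun k => W k s) atTop (𝓝 w)) :
    w = 0 := by
  -- the closed sets `C N`
  set C : ℕ → Set ℝ := fun N => {s | ∀ k, |W k s| ≤ N} with hC
  have hCclosed : ∀ N, IsClosed (C N) := fun N => by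
    have h : C N = ⋂ k, {s | |W k s| ≤ N} := by
      ext s
      simp only [hC, Set.mem_setOf_eq, Set.mem_iInter]
    rw [h]
    exact isClosed_iInter fun k => isClosed_le (continuous_abs.comp (hWc k)) continuous_const
  have hCcover : ⋃ N, C N = Set.univ := by
    refine Set.eq_univ_of_forall fun s => ?_
    obtain ⟨R, hR⟩ := (Metric.isBounded_iff_subset_closedBall (0 : ℝ)).1
      (Metric.isBounded_range_of_tendsto _ (hW s))
    refine Set.mem_iUnion.2 ⟨⌈R⌉₊, fun k => ?_⟩
    have hk := hR (Set.mem_range_self k)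
    rw [Metric.mem_closedBall, Real.dist_eq, sub_zero] at hk
    exact hk.trans (Nat.le_ceil R)
  obtain ⟨N, s₀, hs₀⟩ := nonempty_interior_of_iUnion_of_closed hCclosed hCcover
  obtain ⟨ε, hε, hball⟩ := Metric.isOpen_iff.1 isOpen_interior s₀ hs₀
  -- an interval inside `C N`
  have hsub : Set.Icc (s₀ - ε / 2) (s₀ + ε / 2) ⊆ C N := fun s hs =>
    interior_subset (hball (by
      rw [Metric.mem_ball, Real.dist_eq, abs_lt]
      constructor <;> linarith [hs.1, hs.2]))
  have hαβ : s₀ - ε / 2 < s₀ + ε / 2 := by linarith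
  -- FTC on `[α, β]`
  have hFTC : ∀ k, ∫ s in (s₀ - ε / 2)..(s₀ + ε / 2), W k s = φ k (s₀ - ε / 2) - φ k (s₀ + ε / 2) := by
    intro k
    have h := intervalIntegral.integral_eq_sub_of_hasDerivAt (f := φ k) (f' := fun s => -(W k s))
      (a := s₀ - ε / 2) (b := s₀ + ε / 2) (fun s _ => hd k s) ((hWc k).neg.intervalIntegrable _ _)
    rw [intervalIntegral.integral_neg] at h
    linarith
  -- two limits of the same sequence of integrals
  have h1 : Tendsto (fun k => ∫ s in (s₀ - ε / 2)..(s₀ + ε / 2), W k s) atTop (𝓝 (c - c)) := by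
    have h := (hφ (s₀ - ε / 2)).sub (hφ (s₀ + ε / 2))
    exact h.congr fun k => (hFTC k).symm
  have h2 : Tendsto (fun k => ∫ s in (s₀ - ε / 2)..(s₀ + ε / 2), W k s) atTop
      (𝓝 (∫ _ in (s₀ - ε / 2)..(s₀ + ε / 2), w)) := by
    refine intervalIntegral.tendsto_integral_filter_of_dominated_convergence (fun _ => (N : ℝ)) ?_ ?_ ?_ ?_
    · exact Eventually.of_forall fun k => (hWc k).aestronglyMeasurable
    · refine Eventually.of_forall fun k => Eventually.of_forall fun s hs => ?_
      rw [Real.norm_eq_abs]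
      have hs' : s ∈ Set.Icc (s₀ - ε / 2) (s₀ + ε / 2) := by
        rw [← Set.uIcc_of_le hαβ.le]
        exact Set.uIoc_subset_uIcc hs
      exact hsub hs' k
    · exact intervalIntegrable_const
    · exact Eventually.of_forall fun s _ => hW s
  rw [intervalIntegral.integral_const, smul_eq_mul] at h2
  rw [sub_self] at h1
  have h := tendsto_nhds_unique h2 h1
  have hne : s₀ + ε / 2 - (s₀ - ε / 2) ≠ 0 := by linarith
  exact (mul_eq_zero.1 h).resolve_left hne

/-! ## §2 Lattice rotation-Ward nullity from plane-rotation invariance of the tied limit -/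

section Core

variable {G : Type} [Group G] [TopologicalSpace G] [IsTopologicalGroup G] [CompactSpace G]
  [MeasurableSpace G] [BorelSpace G]

/-- **Ward nullity from plane-rotation invariance** (the converse of `plane_apply_eq_of_wardNullity`).  If the renormalised
Wilson correlators converge to `S` on off-diagonal real tensors (the TIE, `n ≠ 0`) and the curvature-string functionals
`S n (curvature string)` are invariant on `⁰𝒮` under every `(x₀,x₁)`-rotation `ρ_θ = planeRot 0 θ`, then for every real
family `f` with compact, pairwise disjoint supports (`n ≠ 0`) the angle-`0` lattice Ward functional
`Σᵢ ⟨Φ_k(f₁) ⋯ Φ_k(L fᵢ) ⋯ Φ_k(f_n)⟩_k` tends to `0`.  Proof: the tie at the rotated families makes `θ ↦ ⟨∏Φ_k(fⱼ^θ)⟩_k` and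
`θ ↦ W_k(θ; f)` converge pointwise to constants (invariance of the limits); `d/dθ ⟨∏Φ_k(fⱼ^θ)⟩_k = −W_k(θ; f)`
(`stub_angleCalculus`), so `limit_of_derivs_eq_zero` applies. [folklore] -/
theorem wardNullity_of_planeInvariance (r : LatticeRep G) (sch : SpeciesScheme (YMSpecies G))
    (S : LabelledSchwingerFamily (YMSpecies G) (EuclideanSpace ℝ (Fin 4)))
    (hconv : ∀ (n : ℕ), n ≠ 0 → ∀ (σ : Fin n → YMSpecies G) (f : Fin n → 𝓢(EuclideanSpace ℝ (Fin 4), ℝ))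
      (F : 𝓢((Fin n → EuclideanSpace ℝ (Fin 4)), ℂ)),
      IsTensorOf F (fun i => ofRealTest (f i)) → IsOffDiagonal F →
        Tendsto (fun k : ℕ => ((latticeSchwinger r.ρ sch (fun s => s.F) k n σ f : ℝ) : ℂ)) atTop
          (𝓝 (S n σ F)))
    (hrot : ∀ (θ : ℝ) (m : ℕ) (F : 𝓢((Fin m → EuclideanSpace ℝ (Fin 4)), ℂ)), IsOffDiagonal F →
      S m (fun _ => r.curvature) (linActMulti (planeRot (d := 3) 0 θ) F) = S m (fun _ => r.curvature) F)
    {n : ℕ} (hn : n ≠ 0) (f : Fin n → 𝓢(EuclideanSpace ℝ (Fin 4), ℝ))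
    (hf : (∀ i, HasCompactSupport (f i : EuclideanSpace ℝ (Fin 4) → ℝ)) ∧
      ∀ i j, i ≠ j → Disjoint (tsupport (f i : EuclideanSpace ℝ (Fin 4) → ℝ))
        (tsupport (f j : EuclideanSpace ℝ (Fin 4) → ℝ))) :
    Tendsto
      (fun k : ℕ => ∑ i : Fin n,
        latticeSchwinger r.ρ sch (fun s => s.F) k n (fun _ => r.curvature)
          (Function.update f i
            (SchwartzMap.smulLeftCLM ℝ (fun x : EuclideanSpace ℝ (Fin 4) => x 1)
                (LineDeriv.lineDerivOp (EuclideanSpace.single (0 : Fin 4) (1 : ℝ) : EuclideanSpace ℝ (Fin 4)) (f i)) -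
              SchwartzMap.smulLeftCLM ℝ (fun x : EuclideanSpace ℝ (Fin 4) => x 0)
                (LineDeriv.lineDerivOp (EuclideanSpace.single (1 : Fin 4) (1 : ℝ) : EuclideanSpace ℝ (Fin 4)) (f i)))))
      atTop (𝓝 0) := by
  -- the generator family `L f`, the updated families `g i`, the rotated families
  set Lf : Fin n → 𝓢(EuclideanSpace ℝ (Fin 4), ℝ) := fun i =>
    SchwartzMap.smulLeftCLM ℝ (fun x : EuclideanSpace ℝ (Fin 4) => x 1)
        (LineDeriv.lineDerivOp (EuclideanSpace.single (0 : Fin 4) (1 : ℝ) : EuclideanSpace ℝ (Fin 4)) (f i)) -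
      SchwartzMap.smulLeftCLM ℝ (fun x : EuclideanSpace ℝ (Fin 4) => x 0)
        (LineDeriv.lineDerivOp (EuclideanSpace.single (1 : Fin 4) (1 : ℝ) : EuclideanSpace ℝ (Fin 4)) (f i))
    with hLf
  set g : Fin n → Fin n → 𝓢(EuclideanSpace ℝ (Fin 4), ℝ) := fun i => Function.update f i (Lf i) with hg
  set LS : ℕ → (Fin n → 𝓢(EuclideanSpace ℝ (Fin 4), ℝ)) → ℝ := fun k h =>
    latticeSchwinger r.ρ sch (fun s => s.F) k n (fun _ => r.curvature) h with hLS
  set γ : (Fin n → 𝓢(EuclideanSpace ℝ (Fin 4), ℝ)) → ℝ → Fin n → 𝓢(EuclideanSpace ℝ (Fin 4), ℝ) :=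
    fun h θ j => linActTest (planeRot (d := 3) 0 θ) (h j) with hγ
  -- the updated families are separated
  have hgsep : ∀ i a b, a ≠ b → Disjoint (tsupport (g i a : EuclideanSpace ℝ (Fin 4) → ℝ))
      (tsupport (g i b : EuclideanSpace ℝ (Fin 4) → ℝ)) := by
    intro i a b hab
    have hsub : ∀ c, tsupport (g i c : EuclideanSpace ℝ (Fin 4) → ℝ) ⊆ tsupport (f c : EuclideanSpace ℝ (Fin 4) → ℝ) :=
      fun c => by
        by_cases hci : c = i
        · subst hci
          simp only [hg, Function.update_self, hLf]
          exact tsupport_rotGen_subset _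
        · simp only [hg, Function.update_of_ne hci]
          exact subset_rfl
    exact (hf.2 a b hab).mono (hsub a) (hsub b)
  -- the TIE at a rotated separated family, read through the invariance: a constant limit
  have hlim : ∀ (h : Fin n → 𝓢(EuclideanSpace ℝ (Fin 4), ℝ)),
      (∀ a b, a ≠ b → Disjoint (tsupport (h a : EuclideanSpace ℝ (Fin 4) → ℝ))
        (tsupport (h b : EuclideanSpace ℝ (Fin 4) → ℝ))) →
      ∀ θ : ℝ, Tendsto (fun k => LS k (γ h θ)) atTop
        (𝓝 (S n (fun _ => r.curvature) (SchwartzMap.tensorFin n fun j => ofRealTest (h j))).re) := by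
    intro h hh θ
    have hF : IsTensorOf (SchwartzMap.tensorFin n fun j => ofRealTest (h j)) fun j => ofRealTest (h j) :=
      isTensorOf_tensorFin _
    have hod : IsOffDiagonal (SchwartzMap.tensorFin n fun j => ofRealTest (h j)) :=
      isOffDiagonal_of_disjoint_tsupport hh hF
    have ht := hconv n hn (fun _ => r.curvature) (γ h θ)
      (linActMulti (planeRot (d := 3) 0 θ) (SchwartzMap.tensorFin n fun j => ofRealTest (h j)))
      (hF.linActMulti _) (isOffDiagonal_linActMulti _ hod)
    rw [hrot θ n _ hod] at ht
    have h' := (Complex.continuous_re.tendsto _).comp ht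
    simpa only [Function.comp_def, Complex.ofReal_re] using h'
  -- the rotated correlator and the Ward functional of the rotated families
  set φ : ℕ → ℝ → ℝ := fun k θ => LS k (γ f θ) with hφ
  set W : ℕ → ℝ → ℝ := fun k θ => ∑ i : Fin n, LS k (γ (g i) θ) with hW
  -- rotating an updated family = updating the rotated family
  have hupd : ∀ (i : Fin n) (θ : ℝ), γ (g i) θ =
      Function.update (γ f θ) i (linActTest (planeRot (d := 3) 0 θ) (Lf i)) := by
    intro i θ
    funext j
    simp only [hγ, hg]
    exact Function.apply_update (fun _ (ψ : 𝓢(EuclideanSpace ℝ (Fin 4), ℝ)) =>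
      linActTest (planeRot (d := 3) 0 θ) ψ) f i (Lf i) j
  -- angle calculus (landed): `φ_k' = −W_k`
  have hd : ∀ k θ, HasDerivAt (φ k) (-(W k θ)) θ := by
    intro k θ
    have h := stub_angleCalculus G r sch k n f θ
    simp only [hW, hupd]
    exact h
  -- every `W_k` is continuous: each term is a rotated correlator of an updated family, differentiable by the angle calculus
  have hWc : ∀ k, Continuous (W k) := fun k => by
    refine continuous_finsetSum _ fun i _ => ?_
    exact continuous_iff_continuousAt.2 fun θ => (stub_angleCalculus G r sch k n (g i) θ).continuousAt
  -- pointwise limits (constants)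
  have hφlim : ∀ θ, Tendsto (fun k => φ k θ) atTop
      (𝓝 (S n (fun _ => r.curvature) (SchwartzMap.tensorFin n fun j => ofRealTest (f j))).re) :=
    fun θ => hlim f hf.2 θ
  have hWlim : ∀ θ, Tendsto (fun k => W k θ) atTop
      (𝓝 (∑ i : Fin n, (S n (fun _ => r.curvature) (SchwartzMap.tensorFin n fun j => ofRealTest (g i j))).re)) :=
    fun θ => tendsto_finsetSum _ fun i _ => hlim (g i) (hgsep i) θ
  have hw0 := limit_of_derivs_eq_zero hd hWc hφlim hWlim
  -- the goal sequence is the Ward functional at angle `0`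
  have h0 : Tendsto (fun k => ∑ i : Fin n, LS k (g i)) atTop
      (𝓝 (∑ i : Fin n, (S n (fun _ => r.curvature) (SchwartzMap.tensorFin n fun j => ofRealTest (g i j))).re)) := by
    refine tendsto_finsetSum _ fun i _ => ?_
    have h := hlim (g i) (hgsep i) 0
    have hγ0 : γ (g i) 0 = g i := linActTest_rho_zero_family (g i)
    rwa [hγ0] at h
  rw [hw0] at h0
  simpa only [hLS, hg, hLf] using h0

omit [TopologicalSpace G] [IsTopologicalGroup G] [CompactSpace G] [BorelSpace G] in
/-- **All `(x₀,x₁)`-rotations from proper-hypercubic + Σ5 invariance** of the `σ`-string functionals of a labelled family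
on `⁰𝒮`: the landed density upgrade (`Upgrade.upgrade`, Niven + Givens) applied to the one-label family
`n ↦ S n (fun _ ↦ σ)`, and `det ρ_θ = 1`. [cite: Niven1956, Cor. 3.12] -/
theorem rot_invariant_of_hyper_of_sigmaFive (S : LabelledSchwingerFamily (YMSpecies G) (EuclideanSpace ℝ (Fin 4)))
    (σ : YMSpecies G)
    (hcubic : ∀ (n : ℕ) (R : EuclideanSpace ℝ (Fin 4) ≃ₗᵢ[ℝ] EuclideanSpace ℝ (Fin 4)),
      LinearMap.det (R.toLinearEquiv : EuclideanSpace ℝ (Fin 4) →ₗ[ℝ] EuclideanSpace ℝ (Fin 4)) = 1 →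
      (∀ i : Fin 4, ∃ j : Fin 4, R (EuclideanSpace.single i 1) = EuclideanSpace.single j 1 ∨
        R (EuclideanSpace.single i 1) = -EuclideanSpace.single j 1) →
      ∀ F : 𝓢((Fin n → EuclideanSpace ℝ (Fin 4)), ℂ), IsOffDiagonal F →
        S n (fun _ => σ) (linActMulti R F) = S n (fun _ => σ) F)
    (hsigma : ∀ R : EuclideanSpace ℝ (Fin 4) ≃ₗᵢ[ℝ] EuclideanSpace ℝ (Fin 4),
      (R (EuclideanSpace.single 0 1) = EuclideanSpace.single 0 1 ∧
        R (EuclideanSpace.single 1 1) = EuclideanSpace.single 1 1 ∧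
        R (EuclideanSpace.single 2 1) =
          (3 / 5 : ℝ) • EuclideanSpace.single 2 1 + (4 / 5 : ℝ) • EuclideanSpace.single 3 1 ∧
        R (EuclideanSpace.single 3 1) =
          -((4 / 5 : ℝ) • EuclideanSpace.single 2 1) + (3 / 5 : ℝ) • EuclideanSpace.single 3 1) →
      ∀ (n : ℕ) (F : 𝓢((Fin n → EuclideanSpace ℝ (Fin 4)), ℂ)), IsOffDiagonal F →
        S n (fun _ => σ) (linActMulti R F) = S n (fun _ => σ) F)
    (θ : ℝ) (n : ℕ) (F : 𝓢((Fin n → EuclideanSpace ℝ (Fin 4)), ℂ)) (hF : IsOffDiagonal F) :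
    S n (fun _ => σ) (linActMulti (planeRot (d := 3) 0 θ) F) = S n (fun _ => σ) F :=
  upgrade (ι := Unit) (fun m _ => S m fun _ => σ) (fun m _ R hR hax F hF => hcubic m R hR hax F hF)
    (fun R hR m _ F hF => hsigma R hR m F hF) n (fun _ => ()) (planeRot (d := 3) 0 θ) (det_rho θ) F hF

end Core

/-! ## §3 The certificate: `CurvatureAmnesia ↔ (W₂)` -/

/-- **The crux implies the registered hard stub (W₂)** (statement of `stub_wardNullity_two_le` expanded verbatim): under the
crux, the Σ5 clause and the proper-hypercubic guard give invariance of the curvature-string functionals under every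
`(x₀,x₁)`-rotation (`rot_invariant_of_hyper_of_sigmaFive`), and `wardNullity_of_planeInvariance` gives the lattice Ward nullity
(the Borel structure of `G`, an instance binder in the stub, is identified with the crux's `borel G` by `BorelSpace.measurable_eq`). -/
theorem stub_wardNullity_two_le_of_curvatureAmnesia
    (hA : Summit.QuantumFields.YangMills.Theses.CoincidenceRotationBootstrap.CurvatureAmnesia) :
    ∀ (G : Type) [Group G] [TopologicalSpace G] [IsTopologicalGroup G] [CompactSpace G] [MeasurableSpace G]
      [BorelSpace G], IsCompactSimpleLieGroup G →
        ∀ (r : LatticeRep G) (sch : SpeciesScheme (YMSpecies G))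
          (S : LabelledSchwingerFamily (YMSpecies G) (EuclideanSpace ℝ (Fin 4))),
          sch.HasWeakCouplingLimit →
            (S.IsNormalized ∧ S.IsHermitian ∧ S.HasLinearGrowth ∧ S.IsReflectionPositive ∧ S.IsSymmetric ∧
              S.HasClusterProperty ∧
              (∀ (n : ℕ) (k : Fin n → YMSpecies G) (a : EuclideanSpace ℝ (Fin 4))
                (F : 𝓢((Fin n → EuclideanSpace ℝ (Fin 4)), ℂ)), IsOffDiagonal F →
                  S n k (translateMulti a F) = S n k F) ∧
              (∀ (n : ℕ) (k : Fin n → YMSpecies G)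
                (R : EuclideanSpace ℝ (Fin 4) ≃ₗᵢ[ℝ] EuclideanSpace ℝ (Fin 4)),
                LinearMap.det (R.toLinearEquiv : EuclideanSpace ℝ (Fin 4) →ₗ[ℝ] EuclideanSpace ℝ (Fin 4)) = 1 →
                (∀ i : Fin 4, ∃ j : Fin 4, R (EuclideanSpace.single i 1) = EuclideanSpace.single j 1 ∨
                  R (EuclideanSpace.single i 1) = -EuclideanSpace.single j 1) →
                ∀ F : 𝓢((Fin n → EuclideanSpace ℝ (Fin 4)), ℂ), IsOffDiagonal F →
                  S n k (linActMulti R F) = S n k F)) →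
            (∀ (n : ℕ), n ≠ 0 → ∀ (σ : Fin n → YMSpecies G) (f : Fin n → 𝓢(EuclideanSpace ℝ (Fin 4), ℝ))
              (F : 𝓢((Fin n → EuclideanSpace ℝ (Fin 4)), ℂ)),
              IsTensorOf F (fun i => ofRealTest (f i)) → IsOffDiagonal F →
                Tendsto (fun k : ℕ => ((latticeSchwinger r.ρ sch (fun s => s.F) k n σ f : ℝ) : ℂ)) atTop
                  (𝓝 (S n σ F))) →
            (∃ (F₁ G₁ : 𝓢((Fin 1 → EuclideanSpace ℝ (Fin 4)), ℂ))
                (H₁ : 𝓢((Fin (1 + 1) → EuclideanSpace ℝ (Fin 4)), ℂ)),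
              IsTimeOrdered F₁ ∧ IsTimeOrdered G₁ ∧ IsAppendTensorOf H₁ (osAdjoint F₁) G₁ ∧
                S (1 + 1) (fun _ => r.curvature) H₁ ≠
                  S 1 (fun _ => r.curvature) (osAdjoint F₁) * S 1 (fun _ => r.curvature) G₁) →
            (∃ Δ : ℝ, 0 < Δ ∧ S.HasMassGap Δ ∧ HasLatticeMassGap r sch Δ) →
              ∀ (n : ℕ), 2 ≤ n → ∀ (f : Fin n → 𝓢(EuclideanSpace ℝ (Fin 4), ℝ)),
                ((∀ i, HasCompactSupport (f i : EuclideanSpace ℝ (Fin 4) → ℝ)) ∧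
                  ∀ i j, i ≠ j → Disjoint (tsupport (f i : EuclideanSpace ℝ (Fin 4) → ℝ))
                    (tsupport (f j : EuclideanSpace ℝ (Fin 4) → ℝ))) →
                Tendsto
                  (fun k : ℕ => ∑ i : Fin n,
                    latticeSchwinger r.ρ sch (fun s => s.F) k n (fun _ => r.curvature)
                      (Function.update f i
                        (SchwartzMap.smulLeftCLM ℝ (fun x : EuclideanSpace ℝ (Fin 4) => x 1)
                            (LineDeriv.lineDerivOp (EuclideanSpace.single (0 : Fin 4) (1 : ℝ) :
                              EuclideanSpace ℝ (Fin 4)) (f i)) -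
                          SchwartzMap.smulLeftCLM ℝ (fun x : EuclideanSpace ℝ (Fin 4) => x 0)
                            (LineDeriv.lineDerivOp (EuclideanSpace.single (1 : Fin 4) (1 : ℝ) :
                              EuclideanSpace ℝ (Fin 4)) (f i)))))
                  atTop (𝓝 0) := by
  intro G _ _ _ _ instM instB hG r sch S hWk hax hconv hNT hgap n hn f hf
  have hmeas : instM = borel G := BorelSpace.measurable_eq
  subst hmeas
  letI : MeasurableSpace G := borel G
  have hS5 := hA G hG r sch S hWk hax hconv hNT hgap
  have hrot : ∀ (θ : ℝ) (m : ℕ) (F : 𝓢((Fin m → EuclideanSpace ℝ (Fin 4)), ℂ)), IsOffDiagonal F →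
      S m (fun _ => r.curvature) (linActMulti (planeRot (d := 3) 0 θ) F) = S m (fun _ => r.curvature) F :=
    fun θ m F hF => rot_invariant_of_hyper_of_sigmaFive S r.curvature
      (fun m R hR hx F hF => hax.2.2.2.2.2.2.2 m (fun _ => r.curvature) R hR hx F hF) hS5 θ m F hF
  exact wardNullity_of_planeInvariance r sch S hconv hrot (by omega) f hf

/-- **Equivalence certificate of line `WardDefectSketch`**: the crux `CurvatureAmnesia` holds if and only if its registered
hard stub (W₂) `stub_wardNullity_two_le` does.  `→` is `stub_wardNullity_two_le_of_curvatureAmnesia`; `←` is the landed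
funnel `stub_cruxOfWardNullity` fed the all-arity Ward statement assembled from the landed (W₁) `stub_wardNullity_one`
(degree `1`, tie only), (W₂) (degrees `≥ 2`) and the empty sum (degree `0`); the two route copies of the crux are
definitionally equal. [folklore] -/
theorem curvatureAmnesia_iff_wardNullity_two_le :
    Summit.QuantumFields.YangMills.Theses.CoincidenceRotationBootstrap.CurvatureAmnesia ↔
    ∀ (G : Type) [Group G] [TopologicalSpace G] [IsTopologicalGroup G] [CompactSpace G] [MeasurableSpace G]
      [BorelSpace G], IsCompactSimpleLieGroup G →
        ∀ (r : LatticeRep G) (sch : SpeciesScheme (YMSpecies G))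
          (S : LabelledSchwingerFamily (YMSpecies G) (EuclideanSpace ℝ (Fin 4))),
          sch.HasWeakCouplingLimit →
            (S.IsNormalized ∧ S.IsHermitian ∧ S.HasLinearGrowth ∧ S.IsReflectionPositive ∧ S.IsSymmetric ∧
              S.HasClusterProperty ∧
              (∀ (n : ℕ) (k : Fin n → YMSpecies G) (a : EuclideanSpace ℝ (Fin 4))
                (F : 𝓢((Fin n → EuclideanSpace ℝ (Fin 4)), ℂ)), IsOffDiagonal F →
                  S n k (translateMulti a F) = S n k F) ∧
              (∀ (n : ℕ) (k : Fin n → YMSpecies G)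
                (R : EuclideanSpace ℝ (Fin 4) ≃ₗᵢ[ℝ] EuclideanSpace ℝ (Fin 4)),
                LinearMap.det (R.toLinearEquiv : EuclideanSpace ℝ (Fin 4) →ₗ[ℝ] EuclideanSpace ℝ (Fin 4)) = 1 →
                (∀ i : Fin 4, ∃ j : Fin 4, R (EuclideanSpace.single i 1) = EuclideanSpace.single j 1 ∨
                  R (EuclideanSpace.single i 1) = -EuclideanSpace.single j 1) →
                ∀ F : 𝓢((Fin n → EuclideanSpace ℝ (Fin 4)), ℂ), IsOffDiagonal F →
                  S n k (linActMulti R F) = S n k F)) →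
            (∀ (n : ℕ), n ≠ 0 → ∀ (σ : Fin n → YMSpecies G) (f : Fin n → 𝓢(EuclideanSpace ℝ (Fin 4), ℝ))
              (F : 𝓢((Fin n → EuclideanSpace ℝ (Fin 4)), ℂ)),
              IsTensorOf F (fun i => ofRealTest (f i)) → IsOffDiagonal F →
                Tendsto (fun k : ℕ => ((latticeSchwinger r.ρ sch (fun s => s.F) k n σ f : ℝ) : ℂ)) atTop
                  (𝓝 (S n σ F))) →
            (∃ (F₁ G₁ : 𝓢((Fin 1 → EuclideanSpace ℝ (Fin 4)), ℂ))
                (H₁ : 𝓢((Fin (1 + 1) → EuclideanSpace ℝ (Fin 4)), ℂ)),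
              IsTimeOrdered F₁ ∧ IsTimeOrdered G₁ ∧ IsAppendTensorOf H₁ (osAdjoint F₁) G₁ ∧
                S (1 + 1) (fun _ => r.curvature) H₁ ≠
                  S 1 (fun _ => r.curvature) (osAdjoint F₁) * S 1 (fun _ => r.curvature) G₁) →
            (∃ Δ : ℝ, 0 < Δ ∧ S.HasMassGap Δ ∧ HasLatticeMassGap r sch Δ) →
              ∀ (n : ℕ), 2 ≤ n → ∀ (f : Fin n → 𝓢(EuclideanSpace ℝ (Fin 4), ℝ)),
                ((∀ i, HasCompactSupport (f i : EuclideanSpace ℝ (Fin 4) → ℝ)) ∧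
                  ∀ i j, i ≠ j → Disjoint (tsupport (f i : EuclideanSpace ℝ (Fin 4) → ℝ))
                    (tsupport (f j : EuclideanSpace ℝ (Fin 4) → ℝ))) →
                Tendsto
                  (fun k : ℕ => ∑ i : Fin n,
                    latticeSchwinger r.ρ sch (fun s => s.F) k n (fun _ => r.curvature)
                      (Function.update f i
                        (SchwartzMap.smulLeftCLM ℝ (fun x : EuclideanSpace ℝ (Fin 4) => x 1)
                            (LineDeriv.lineDerivOp (EuclideanSpace.single (0 : Fin 4) (1 : ℝ) :
                              EuclideanSpace ℝ (Fin 4)) (f i)) -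
                          SchwartzMap.smulLeftCLM ℝ (fun x : EuclideanSpace ℝ (Fin 4) => x 0)
                            (LineDeriv.lineDerivOp (EuclideanSpace.single (1 : Fin 4) (1 : ℝ) :
                              EuclideanSpace ℝ (Fin 4)) (f i)))))
                  atTop (𝓝 0) := by
  refine ⟨stub_wardNullity_two_le_of_curvatureAmnesia, fun h₂ => ?_⟩
  refine stub_cruxOfWardNullity ?_
  intro G _ _ _ _ _ _ hG r sch S hW hax hconv hNT hgap n f hf
  rcases n with _ | _ | n
  · simp only [Finset.univ_eq_empty, Finset.sum_empty]
    exact tendsto_const_nhds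
  · exact stub_wardNullity_one G r sch S hconv f
  · exact h₂ G hG r sch S hW hax hconv hNT hgap (n + 2) (by omega) f hf

end Summit.QuantumFields.YangMills.Cruxes.CurvatureAmnesia.WardDefect

end
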